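import Literature.Topology.FourManifolds.FoldChartSigAssembly
import HarnessLib

/-!
# The fold model of arbitrary signature and the critical set in a fold chart

Topic `Literature/Topology/FourManifolds` (programme of the fact
`Literature.Topology.FourManifolds.exists_isSimplifiedBrokenLefschetzFibration`, Baykur–Saeki 2017, §2.1:
folds `(t, ±x² ± y² ± z²)`; the fold locus is 1-dimensional and the map restricted to it is an
immersion).  The sign-generic companion of `IndefiniteFoldModel.lean`: the model
`(t, x₁, x₂, x₃) ↦ (t, s₁x₁² + s₂x₂² + s₃x₃²)` (`sᵢ ≠ 0`), its derivative, "`dF` onto iff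
`(x₁, x₂, x₃) ≠ 0`", injectivity on the critical set, and the chart transport: for a map
`f : X → B` with a fold chart of signature `(s₁, s₂, s₃)` (`HasManifoldFoldChart`-style data),
the critical points in the chart are `φ⁻¹` of the `t`-axis and `f` is injective on them.

Everything is proved; the model map and its derivative are the only definitions; no named
facts (D-0026).

## References

* R. İ. Baykur, O. Saeki, *Simplifying indefinite fibrations on 4-manifolds*, arXiv:1705.11169,
  §2.1, p. 6. [BaykurSaeki2017]
* M. Golubitsky, V. Guillemin, *Stable Mappings and Their Singularities*, GTM 14 (1973), Ch. III
  §4 (submersions with folds). [GolubitskyGuillemin1973]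
-/

noncomputable section

open scoped Manifold ContDiff Topology
open Set Function

namespace Literature.Topology.FourManifolds

/-- Local notation: `𝔼 n` is the model Euclidean space `EuclideanSpace ℝ (Fin n)`. -/
local notation "𝔼 " n:arg => EuclideanSpace ℝ (Fin n)

/-! ### The model map and its derivative -/

variable (s₁ s₂ s₃ : ℝ)

/-- **The fold of signature `(s₁, s₂, s₃)`** `ℝ⁴ → ℝ²`, `(t, x₁, x₂, x₃) ↦ (t, s₁x₁² + s₂x₂² + s₃x₃²)`
(Baykur–Saeki 2017, §2.1: `(t, ±x² ± y² ± z²)`). [cite: BaykurSaeki2017, §2.1] -/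
def foldSigMap (x : 𝔼 4) : 𝔼 2 :=
  (x 0) • EuclideanSpace.single (0 : Fin 2) (1 : ℝ) +
    (s₁ * x 1 ^ 2 + s₂ * x 2 ^ 2 + s₃ * x 3 ^ 2) • EuclideanSpace.single (1 : Fin 2) (1 : ℝ)

/-- First component: `t`. [folklore] -/
@[simp] theorem foldSigMap_apply_zero (x : 𝔼 4) : foldSigMap s₁ s₂ s₃ x 0 = x 0 := by
  simp [foldSigMap]

/-- Second component: `s₁x₁² + s₂x₂² + s₃x₃²`. [folklore] -/
@[simp] theorem foldSigMap_apply_one (x : 𝔼 4) :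
    foldSigMap s₁ s₂ s₃ x 1 = s₁ * x 1 ^ 2 + s₂ * x 2 ^ 2 + s₃ * x 3 ^ 2 := by
  simp [foldSigMap]

variable {s₁ s₂ s₃} in
/-- A point of `ℝ²` in the shape of the fold-chart identities IS the value of the model.
[folklore] -/
theorem eq_foldSigMap_of_apply {x : 𝔼 4} {y : 𝔼 2} (h0 : y 0 = x 0)
    (h1 : y 1 = s₁ * x 1 ^ 2 + s₂ * x 2 ^ 2 + s₃ * x 3 ^ 2) : y = foldSigMap s₁ s₂ s₃ x := by
  ext i
  fin_cases i
  · simpa using h0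
  · simpa using h1

/-- The model is smooth. [folklore] -/
theorem contDiff_foldSigMap : ContDiff ℝ ∞ (foldSigMap s₁ s₂ s₃) := by
  have hc : ∀ i : Fin 4, ContDiff ℝ ∞ fun x : 𝔼 4 => x i := fun i =>
    (EuclideanSpace.proj i : 𝔼 4 →L[ℝ] ℝ).contDiff
  unfold foldSigMap
  exact ((hc 0).smul contDiff_const).add
    ((((contDiff_const.mul ((hc 1).pow 2)).add (contDiff_const.mul ((hc 2).pow 2))).add
      (contDiff_const.mul ((hc 3).pow 2))).smul contDiff_const)

/-- **The derivative of the model** at `x`: `v ↦ (v₀, 2s₁x₁v₁ + 2s₂x₂v₂ + 2s₃x₃v₃)`. [folklore] -/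
def foldSigDeriv (x : 𝔼 4) : 𝔼 4 →L[ℝ] 𝔼 2 :=
  (EuclideanSpace.proj (0 : Fin 4) : 𝔼 4 →L[ℝ] ℝ).smulRight
      (EuclideanSpace.single (0 : Fin 2) (1 : ℝ)) +
    ((2 * s₁ * x 1) • (EuclideanSpace.proj (1 : Fin 4) : 𝔼 4 →L[ℝ] ℝ) +
        (2 * s₂ * x 2) • (EuclideanSpace.proj (2 : Fin 4) : 𝔼 4 →L[ℝ] ℝ) +
        (2 * s₃ * x 3) • (EuclideanSpace.proj (3 : Fin 4) : 𝔼 4 →L[ℝ] ℝ)).smulRight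
      (EuclideanSpace.single (1 : Fin 2) (1 : ℝ))

/-- `(dF_x v)₀ = v₀`. [folklore] -/
@[simp] theorem foldSigDeriv_apply_zero (x v : 𝔼 4) : foldSigDeriv s₁ s₂ s₃ x v 0 = v 0 := by
  simp [foldSigDeriv, ContinuousLinearMap.smulRight_apply]

/-- `(dF_x v)₁ = 2s₁x₁v₁ + 2s₂x₂v₂ + 2s₃x₃v₃`. [folklore] -/
@[simp] theorem foldSigDeriv_apply_one (x v : 𝔼 4) :
    foldSigDeriv s₁ s₂ s₃ x v 1 = 2 * s₁ * x 1 * v 1 + 2 * s₂ * x 2 * v 2 + 2 * s₃ * x 3 * v 3 := by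
  simp [foldSigDeriv, ContinuousLinearMap.smulRight_apply]

/-- The model has derivative `foldSigDeriv x` at `x`. [folklore] -/
theorem hasFDerivAt_foldSigMap (x : 𝔼 4) :
    HasFDerivAt (foldSigMap s₁ s₂ s₃) (foldSigDeriv s₁ s₂ s₃ x) x := by
  have hc : ∀ i : Fin 4, HasFDerivAt (fun x : 𝔼 4 => x i)
      (EuclideanSpace.proj i : 𝔼 4 →L[ℝ] ℝ) x := fun i =>
    (EuclideanSpace.proj i : 𝔼 4 →L[ℝ] ℝ).hasFDerivAt
  have hq : HasFDerivAt (fun x : 𝔼 4 => s₁ * x 1 ^ 2 + s₂ * x 2 ^ 2 + s₃ * x 3 ^ 2)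
      ((2 * s₁ * x 1) • (EuclideanSpace.proj (1 : Fin 4) : 𝔼 4 →L[ℝ] ℝ) +
        (2 * s₂ * x 2) • (EuclideanSpace.proj (2 : Fin 4) : 𝔼 4 →L[ℝ] ℝ) +
        (2 * s₃ * x 3) • (EuclideanSpace.proj (3 : Fin 4) : 𝔼 4 →L[ℝ] ℝ)) x := by
    refine (((((hc 1).pow 2).const_mul s₁).add (((hc 2).pow 2).const_mul s₂)).add
      (((hc 3).pow 2).const_mul s₃)).congr_fderiv ?_
    ext v
    simp
    ring
  exact ((hc 0).smul_const _).add (hq.smul_const _)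

/-- `fderiv` form. [folklore] -/
theorem fderiv_foldSigMap (x : 𝔼 4) :
    fderiv ℝ (foldSigMap s₁ s₂ s₃) x = foldSigDeriv s₁ s₂ s₃ x :=
  (hasFDerivAt_foldSigMap s₁ s₂ s₃ x).fderiv

/-! ### The critical set of the model is the `t`-axis -/

variable {s₁ s₂ s₃}

/-- **The differential is onto iff `(x₁, x₂, x₃) ≠ 0`** (`sᵢ ≠ 0`). [folklore] -/
theorem surjective_foldSigDeriv_iff (hs₁ : s₁ ≠ 0) (hs₂ : s₂ ≠ 0) (hs₃ : s₃ ≠ 0) (x : 𝔼 4) :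
    Surjective (foldSigDeriv s₁ s₂ s₃ x) ↔ ¬ (x 1 = 0 ∧ x 2 = 0 ∧ x 3 = 0) := by
  constructor
  · rintro hs ⟨h1, h2, h3⟩
    obtain ⟨v, hv⟩ := hs (EuclideanSpace.single (1 : Fin 2) (1 : ℝ))
    have h := congrArg (fun w : 𝔼 2 => w 1) hv
    simp [h1, h2, h3] at h
  · intro hx w
    by_cases h1 : x 1 = 0
    · by_cases h2 : x 2 = 0
      · have h3 : x 3 ≠ 0 := fun h3 => hx ⟨h1, h2, h3⟩
        refine ⟨w 0 • EuclideanSpace.single (0 : Fin 4) (1 : ℝ) +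
          (w 1 / (2 * s₃ * x 3)) • EuclideanSpace.single (3 : Fin 4) (1 : ℝ), ?_⟩
        ext i
        fin_cases i
        · simp
        · simp [h1, h2]
          field_simp
      · refine ⟨w 0 • EuclideanSpace.single (0 : Fin 4) (1 : ℝ) +
          (w 1 / (2 * s₂ * x 2)) • EuclideanSpace.single (2 : Fin 4) (1 : ℝ), ?_⟩
        ext i
        fin_cases i
        · simp
        · simp [h1]
          field_simp
    · refine ⟨w 0 • EuclideanSpace.single (0 : Fin 4) (1 : ℝ) +
        (w 1 / (2 * s₁ * x 1)) • EuclideanSpace.single (1 : Fin 4) (1 : ℝ), ?_⟩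
      ext i
      fin_cases i
      · simp
      · simp
        field_simp

/-- `fderiv` form. [folklore] -/
theorem surjective_fderiv_foldSigMap_iff (hs₁ : s₁ ≠ 0) (hs₂ : s₂ ≠ 0) (hs₃ : s₃ ≠ 0) (x : 𝔼 4) :
    Surjective (fderiv ℝ (foldSigMap s₁ s₂ s₃) x) ↔ ¬ (x 1 = 0 ∧ x 2 = 0 ∧ x 3 = 0) := by
  rw [fderiv_foldSigMap, surjective_foldSigDeriv_iff hs₁ hs₂ hs₃]

/-- **The model is injective on its critical set.** [folklore] -/
theorem eq_of_foldSigMap_eq {x x' : 𝔼 4} (hx : x 1 = 0 ∧ x 2 = 0 ∧ x 3 = 0)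
    (hx' : x' 1 = 0 ∧ x' 2 = 0 ∧ x' 3 = 0) (h : foldSigMap s₁ s₂ s₃ x = foldSigMap s₁ s₂ s₃ x') :
    x = x' := by
  have h0 : x 0 = x' 0 := by simpa using congrArg (fun w : 𝔼 2 => w 0) h
  ext i
  fin_cases i
  · simpa using h0
  · simp [hx.1, hx'.1]
  · simp [hx.2.1, hx'.2.1]
  · simp [hx.2.2, hx'.2.2]

/-! ### Chart transport: the critical set of a map with a fold chart of any signature -/

section Transport

variable {X : Type*} [TopologicalSpace X] [ChartedSpace (EuclideanSpace ℝ (Fin 4)) X]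
  {B : Type*} [TopologicalSpace B] [ChartedSpace (EuclideanSpace ℝ (Fin 2)) B]
  {f : X → B} {φ : OpenPartialHomeomorph X (𝔼 4)} {ψ : OpenPartialHomeomorph B (𝔼 2)}

omit [ChartedSpace (EuclideanSpace ℝ (Fin 4)) X] [ChartedSpace (EuclideanSpace ℝ (Fin 2)) B] in
/-- In a fold chart, `ψ ∘ f = F ∘ φ` on `φ.source`. [folklore] -/
theorem apply_eq_foldSigMap_of_foldChart
    (hmodel : ∀ q ∈ φ.source,
      (ψ (f q)) 0 = (φ q) 0 ∧ (ψ (f q)) 1 = s₁ * (φ q) 1 ^ 2 + s₂ * (φ q) 2 ^ 2 + s₃ * (φ q) 3 ^ 2)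
    {q : X} (hq : q ∈ φ.source) : ψ (f q) = foldSigMap s₁ s₂ s₃ (φ q) :=
  eq_foldSigMap_of_apply (hmodel q hq).1 (hmodel q hq).2

omit [ChartedSpace (EuclideanSpace ℝ (Fin 4)) X] [ChartedSpace (EuclideanSpace ℝ (Fin 2)) B] in
/-- In a fold chart, `f = ψ⁻¹ ∘ F ∘ φ` near every point of `φ.source`. [folklore] -/
theorem eventuallyEq_of_foldChartSig (hmaps : MapsTo f φ.source ψ.source)
    (hmodel : ∀ q ∈ φ.source,
      (ψ (f q)) 0 = (φ q) 0 ∧ (ψ (f q)) 1 = s₁ * (φ q) 1 ^ 2 + s₂ * (φ q) 2 ^ 2 + s₃ * (φ q) 3 ^ 2)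
    {q : X} (hq : q ∈ φ.source) : f =ᶠ[𝓝 q] (ψ.symm ∘ foldSigMap s₁ s₂ s₃ ∘ φ) := by
  filter_upwards [φ.open_source.mem_nhds hq] with y hy
  show f y = ψ.symm (foldSigMap s₁ s₂ s₃ (φ y))
  rw [← apply_eq_foldSigMap_of_foldChart hmodel hy, ψ.left_inv (hmaps hy)]

/-- **Chart transport of the critical set.**  Let `f : X → B` be the indefinite fold in smooth
charts `φ` of the 4-manifold `X` (valued in `ℝ⁴`, smooth with smooth inverse) and `ψ` of the
surface `B` (valued in `ℝ²`, smooth with smooth inverse) on `φ.source` — precisely the data of the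
`fold` clause of `IsSimplifiedBrokenLefschetzFibration`.  Then for `q ∈ φ.source` the
differential `df_q` is onto iff `((φ q)₁, (φ q)₂, (φ q)₃) ≠ 0`: by the chain rule
`df_q = d(ψ⁻¹) ∘ dF_{φ q} ∘ dφ_q` with the outer factors invertible
(`OpenPartialHomeomorph.MDifferentiable.mfderiv_bijective`), and `dF` is onto exactly off the
`t`-axis (`surjective_foldSigDeriv s₁ s₂ s₃_iff`).  So the critical points of `f` in `φ.source` are
`φ⁻¹` of the `t`-axis (Baykur–Saeki 2017, §2.1; Hayano 2011, Def. 2.1 (4)). [folklore] -/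
theorem surjective_mfderiv_iff_of_foldChartSig (hmaps : MapsTo f φ.source ψ.source)
    (hφ : ContMDiffOn (𝓡 4) (𝓡 4) ∞ φ φ.source) (hφs : ContMDiffOn (𝓡 4) (𝓡 4) ∞ φ.symm φ.target)
    (hψ : ContMDiffOn (𝓡 2) (𝓡 2) ∞ ψ ψ.source) (hψs : ContMDiffOn (𝓡 2) (𝓡 2) ∞ ψ.symm ψ.target)
    (hmodel : ∀ q ∈ φ.source,
      (ψ (f q)) 0 = (φ q) 0 ∧ (ψ (f q)) 1 = s₁ * (φ q) 1 ^ 2 + s₂ * (φ q) 2 ^ 2 + s₃ * (φ q) 3 ^ 2)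
    (hs₁ : s₁ ≠ 0) (hs₂ : s₂ ≠ 0) (hs₃ : s₃ ≠ 0)
    {q : X} (hq : q ∈ φ.source) :
    Surjective (mfderiv (𝓡 4) (𝓡 2) f q) ↔ ¬ ((φ q) 1 = 0 ∧ (φ q) 2 = 0 ∧ (φ q) 3 = 0) := by
  have hφmd : φ.MDifferentiable (𝓡 4) (𝓡 4) :=
    ⟨hφ.mdifferentiableOn (by simp), hφs.mdifferentiableOn (by simp)⟩
  have hψmd : ψ.MDifferentiable (𝓡 2) (𝓡 2) :=
    ⟨hψ.mdifferentiableOn (by simp), hψs.mdifferentiableOn (by simp)⟩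
  have hyt : foldSigMap s₁ s₂ s₃ (φ q) ∈ ψ.target := by
    rw [← apply_eq_foldSigMap_of_foldChart hmodel hq]
    exact ψ.map_source (hmaps hq)
  have hF : HasMFDerivAt (𝓡 4) (𝓡 2) (foldSigMap s₁ s₂ s₃) (φ q) (foldSigDeriv s₁ s₂ s₃ (φ q)) :=
    (hasFDerivAt_foldSigMap s₁ s₂ s₃ (φ q)).hasMFDerivAt
  have hφq : HasMFDerivAt (𝓡 4) (𝓡 4) φ q (mfderiv (𝓡 4) (𝓡 4) φ q) :=
    (hφmd.mdifferentiableAt hq).hasMFDerivAt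
  have hψq : HasMFDerivAt (𝓡 2) (𝓡 2) ψ.symm (foldSigMap s₁ s₂ s₃ (φ q))
      (mfderiv (𝓡 2) (𝓡 2) ψ.symm (foldSigMap s₁ s₂ s₃ (φ q))) :=
    (hψmd.mdifferentiableAt_symm hyt).hasMFDerivAt
  have hcomp := hψq.comp q (hF.comp q hφq)
  have key : ⇑(mfderiv (𝓡 4) (𝓡 2) f q) =
      ⇑(mfderiv (𝓡 2) (𝓡 2) ψ.symm (foldSigMap s₁ s₂ s₃ (φ q))) ∘ ⇑(foldSigDeriv s₁ s₂ s₃ (φ q)) ∘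
        ⇑(mfderiv (𝓡 4) (𝓡 4) φ q) := by
    rw [(eventuallyEq_of_foldChartSig hmaps hmodel hq).mfderiv_eq, hcomp.mfderiv]
    rfl
  rw [key]
  have hA := hψmd.symm.mfderiv_bijective hyt
  have hC := hφmd.mfderiv_surjective hq
  refine Iff.trans ⟨fun hs => ?_, fun hD => ?_⟩ (surjective_foldSigDeriv_iff hs₁ hs₂ hs₃ (φ q))
  · exact (hs.of_comp_left hA.1).of_comp
  · exact hA.2.comp (hD.comp hC)

/-- **A map is injective on the critical points of a fold chart**: if `q, q' ∈ φ.source` are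
critical points of `f` with `f q = f q'` then `q = q'` (both chart images lie on the `t`-axis,
and `t = (ψ (f q))₀`).  This is the local half of "embedded round image" for any map built from
fold charts. [folklore] -/
theorem injOn_of_foldChartSig (hmaps : MapsTo f φ.source ψ.source)
    (hφ : ContMDiffOn (𝓡 4) (𝓡 4) ∞ φ φ.source) (hφs : ContMDiffOn (𝓡 4) (𝓡 4) ∞ φ.symm φ.target)
    (hψ : ContMDiffOn (𝓡 2) (𝓡 2) ∞ ψ ψ.source) (hψs : ContMDiffOn (𝓡 2) (𝓡 2) ∞ ψ.symm ψ.target)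
    (hmodel : ∀ q ∈ φ.source,
      (ψ (f q)) 0 = (φ q) 0 ∧ (ψ (f q)) 1 = s₁ * (φ q) 1 ^ 2 + s₂ * (φ q) 2 ^ 2 + s₃ * (φ q) 3 ^ 2)
    (hs₁ : s₁ ≠ 0) (hs₂ : s₂ ≠ 0) (hs₃ : s₃ ≠ 0) :
    InjOn f (φ.source ∩ {q | ¬ Surjective (mfderiv (𝓡 4) (𝓡 2) f q)}) := by
  rintro q ⟨hq, hqc⟩ q' ⟨hq', hqc'⟩ hqq'
  rw [mem_setOf_eq, surjective_mfderiv_iff_of_foldChartSig hmaps hφ hφs hψ hψs hmodel hs₁ hs₂ hs₃ ‹_›,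
    not_not] at hqc hqc'
  have h : foldSigMap s₁ s₂ s₃ (φ q) = foldSigMap s₁ s₂ s₃ (φ q') := by
    rw [← apply_eq_foldSigMap_of_foldChart hmodel hq,
      ← apply_eq_foldSigMap_of_foldChart hmodel hq', hqq']
  exact φ.injOn hq hq' (eq_of_foldSigMap_eq hqc hqc' h)

/-- **The critical points in a fold chart are `φ⁻¹` of the `t`-axis** (set form of
`surjective_mfderiv_iff_of_foldChart`). [folklore] -/
theorem inter_setOf_not_surjective_eq_of_foldChartSig (hmaps : MapsTo f φ.source ψ.source)
    (hφ : ContMDiffOn (𝓡 4) (𝓡 4) ∞ φ φ.source) (hφs : ContMDiffOn (𝓡 4) (𝓡 4) ∞ φ.symm φ.target)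
    (hψ : ContMDiffOn (𝓡 2) (𝓡 2) ∞ ψ ψ.source) (hψs : ContMDiffOn (𝓡 2) (𝓡 2) ∞ ψ.symm ψ.target)
    (hmodel : ∀ q ∈ φ.source,
      (ψ (f q)) 0 = (φ q) 0 ∧ (ψ (f q)) 1 = s₁ * (φ q) 1 ^ 2 + s₂ * (φ q) 2 ^ 2 + s₃ * (φ q) 3 ^ 2)
    (hs₁ : s₁ ≠ 0) (hs₂ : s₂ ≠ 0) (hs₃ : s₃ ≠ 0) :
    φ.source ∩ {q | ¬ Surjective (mfderiv (𝓡 4) (𝓡 2) f q)} =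
      φ.source ∩ φ ⁻¹' {x | x 1 = 0 ∧ x 2 = 0 ∧ x 3 = 0} := by
  ext q
  simp only [mem_inter_iff, mem_setOf_eq, mem_preimage]
  constructor
  · rintro ⟨hq, hqc⟩
    exact ⟨hq, not_not.mp
      (mt (surjective_mfderiv_iff_of_foldChartSig hmaps hφ hφs hψ hψs hmodel hs₁ hs₂ hs₃ hq).mpr hqc)⟩
  · rintro ⟨hq, hqc⟩
    exact ⟨hq, fun h =>
      (surjective_mfderiv_iff_of_foldChartSig hmaps hφ hφs hψ hψs hmodel hs₁ hs₂ hs₃ hq).mp h hqc⟩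

end Transport

end Literature.Topology.FourManifolds
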